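import Summits.Ventures.QEC.Census.CertBits
import HarnessLib

/-!
# The support enumeration `scan` of the CSS distance-certificate checker and its completeness
# (plan/CERT-FORMAT.md v1 §5.1 `bruteforce`, lemma L3)

`scan test L b v s` enumerates, by structural include/skip recursion over the position list `L` (each position =
(basis word `2^j`, syndrome column word `colMask H j`)), every way of adding at most `b` further positions to the
partial word `v` / partial syndrome `s`, and demands `test` at each end point. Soundness of the brute-force lower
bound rests on two facts proved here:

* `scan_sublist` — COMPLETENESS: if the scan passes, `test` holds at `(v ⊕ xorFst S, s ⊕ xorSnd S)` for EVERY
  sublist `S` of `L` with `|S| ≤ b`;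
* `ofBits_xorFst_suppList`, `ofBits_xorSnd_suppList`, `length_suppList`, `xorSnd_suppList_eq_zero` — an arbitrary
  vector `w : Fin n → ZMod 2` is the word of the sublist `suppList n H w` of the position list (its support), whose
  syndrome word is `H w` (as a word over the rows) and whose length is the Hamming weight `‖w‖`.

Hence a passing scan with budget `d − 1` has tested every vector of weight `≤ d − 1`, with its true syndrome.
`Reaches` packages "the replay reached every sublist" as a `Prop`, with the two ways of establishing it: one `scan`
(`reaches_of_scan`) or chunk by chunk, keyed by the first selected position (`reaches_of_chunks`, CERT-FORMAT §7
chunk key (side, smallest index)), so that a large lower bound splits into independently `decide`d files.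
-/

namespace Summit.Ventures.QEC.Census

open Matrix Literature.InformationTheory.QuantumCodes

/-! ## The enumeration -/

/-- The position list of a check matrix: for each qubit `j < n` the pair `(2^j, colMask H j)` (the basis word of
qubit `j` and its syndrome column). (definition) -/
def posList (n : ℕ) (H : List ℕ) : List (ℕ × ℕ) := (List.range n).map fun j => (2 ^ j, colMask H j)

/-- `scan test L b v s`: starting from the partial word `v` with partial syndrome `s`, add every sub-selection of at
most `b` of the remaining positions `L` (each position = (word, syndrome column)), XOR-ing both components, and
require `test` at every end point; include/skip recursion, structural on `L`, budget `0` ends at once. Every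
sublist of `L` of length `≤ b` is reached (`scan_sublist`). (definition) -/
def scan (test : ℕ → ℕ → Bool) : List (ℕ × ℕ) → ℕ → ℕ → ℕ → Bool
  | [], _, v, s => test v s
  | _ :: _, 0, v, s => test v s
  | (p, c) :: rest, b + 1, v, s => scan test rest (b + 1) v s && scan test rest b (v ^^^ p) (s ^^^ c)

/-! ## Soundness: the enumeration reaches every sublist -/

section Scan

/-- XOR of the first components. -/
def xorFst (S : List (ℕ × ℕ)) : ℕ := xorList (S.map Prod.fst)

/-- XOR of the second components. -/
def xorSnd (S : List (ℕ × ℕ)) : ℕ := xorList (S.map Prod.snd)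

/-- `xorFst` of a cons. -/
theorem xorFst_cons (a : ℕ × ℕ) (S : List (ℕ × ℕ)) : xorFst (a :: S) = a.1 ^^^ xorFst S := rfl
/-- `xorSnd` of a cons. -/
theorem xorSnd_cons (a : ℕ × ℕ) (S : List (ℕ × ℕ)) : xorSnd (a :: S) = a.2 ^^^ xorSnd S := rfl

/-- With budget `0` the scan is the test at the start point. -/
theorem scan_nil_budget (test : ℕ → ℕ → Bool) (L : List (ℕ × ℕ)) (v s : ℕ) (h : scan test L 0 v s = true) :
    test v s = true := by
  cases L with
  | nil => exact h
  | cons a L => exact h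

/-- **Completeness of the enumeration**: if `scan test L b v s` holds then `test` holds at `(v ⊕ xorFst S, s ⊕ xorSnd S)`
for every sublist `S` of `L` of length `≤ b`. -/
theorem scan_sublist (test : ℕ → ℕ → Bool) :
    ∀ (L : List (ℕ × ℕ)) (b v s : ℕ), scan test L b v s = true →
      ∀ S : List (ℕ × ℕ), S.Sublist L → S.length ≤ b → test (v ^^^ xorFst S) (s ^^^ xorSnd S) = true := by
  intro L
  induction L with
  | nil =>
    intro b v s h S hS _
    rw [List.sublist_nil.mp hS]
    simpa [scan, xorFst, xorSnd, xorList] using h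
  | cons a L ih =>
    intro b v s h S hS hlen
    cases b with
    | zero =>
      have hS0 : S = [] := List.eq_nil_of_length_eq_zero (Nat.le_zero.mp hlen)
      subst hS0
      simpa [xorFst, xorSnd, xorList] using scan_nil_budget test _ v s h
    | succ b =>
      obtain ⟨p, c⟩ := a
      simp only [scan, Bool.and_eq_true] at h
      rcases hS with _ | ⟨_, hS'⟩ | ⟨_, hS'⟩
      · exact ih (b + 1) v s h.1 S hS' hlen
      · rename_i S'
        have hlen' : S'.length ≤ b := by simpa using hlen
        have := ih b (v ^^^ p) (s ^^^ c) h.2 S' hS' hlen'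
        rw [xorFst_cons, xorSnd_cons]
        simpa [Nat.xor_assoc] using this
end Scan

/-! ## Soundness: from a vector to the sublist of its support -/

section Support

variable (n : ℕ) (H : List ℕ)

/-- The support of a vector as a list of qubit indices (increasing). -/
def suppIdx (w : Fin n → ZMod 2) : List ℕ :=
  ((List.finRange n).filter fun j => decide (w j ≠ 0)).map Fin.val

/-- The sub-position-list selected by a vector: the positions `j < n` with `w j ≠ 0`. -/
def suppList (w : Fin n → ZMod 2) : List (ℕ × ℕ) := (suppIdx n w).map fun j => (2 ^ j, colMask H j)

/-- The support list of a vector is a sublist of the full position list. -/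
theorem suppList_sublist (w : Fin n → ZMod 2) : (suppList n H w).Sublist (posList n H) := by
  rw [suppList, suppIdx, posList, ← List.map_coe_finRange_eq_range]
  exact ((List.filter_sublist).map _).map _

/-- The support index list has no duplicates. -/
theorem nodup_suppIdx (w : Fin n → ZMod 2) : (suppIdx n w).Nodup :=
  ((List.nodup_finRange n).filter _).map Fin.val_injective

/-- Membership in the support index list. -/
theorem mem_suppIdx_iff (w : Fin n → ZMod 2) (i : Fin n) : (i : ℕ) ∈ suppIdx n w ↔ w i ≠ 0 := by
  simp only [suppIdx, List.mem_map, List.mem_filter, List.mem_finRange, true_and, decide_eq_true_eq]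
  constructor
  · rintro ⟨j, hj, hji⟩
    rwa [← Fin.ext hji]
  · exact fun h => ⟨i, h, rfl⟩

/-- Support indices are `< n`. -/
theorem lt_of_mem_suppIdx (w : Fin n → ZMod 2) {j : ℕ} (hj : j ∈ suppIdx n w) : j < n := by
  simp only [suppIdx, List.mem_map, List.mem_filter] at hj
  obtain ⟨i, -, rfl⟩ := hj
  exact i.2

/-- The support list of `w` has length `‖w‖` (Hamming weight). -/
theorem length_suppList (w : Fin n → ZMod 2) : (suppList n H w).length = hammingNorm w := by
  rw [suppList, List.length_map, suppIdx, List.length_map, hammingNorm,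
    ← List.toFinset_card_of_nodup ((List.nodup_finRange n).filter _), List.toFinset_filter,
    List.toFinset_finRange]
  congr 1
  ext i
  simp

/-- bits of a XOR of distinct powers of two = membership. -/
theorem testBit_xorList_pow (J : List ℕ) (hJ : J.Nodup) (i : ℕ) :
    (xorList (J.map fun j => 2 ^ j)).testBit i = decide (i ∈ J) := by
  induction J with
  | nil => simp [xorList]
  | cons a J ih =>
    rw [List.nodup_cons] at hJ
    rw [List.map_cons, xorList, Nat.testBit_xor, ih hJ.2, Nat.testBit_two_pow]
    by_cases hai : a = i
    · subst hai
      simp [hJ.1]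
    · have hia : ¬ i = a := fun e => hai e.symm
      simp [hai, hia]

/-- The word of the support list is the vector itself. -/
theorem ofBits_xorFst_suppList (w : Fin n → ZMod 2) : ofBits n (xorFst (suppList n H w)) = w := by
  have hx : xorFst (suppList n H w) = xorList ((suppIdx n w).map fun j => 2 ^ j) := by
    rw [xorFst, suppList, List.map_map]
    rfl
  funext i
  rw [hx, ofBits, testBit_xorList_pow _ (nodup_suppIdx n w)]
  by_cases hi : w i = 0
  · have : ¬ ((i : ℕ) ∈ suppIdx n w) := fun h => (mem_suppIdx_iff n w i).1 h hi
    simp [this, hi]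
  · have hmem : (i : ℕ) ∈ suppIdx n w := (mem_suppIdx_iff n w i).2 hi
    have h1 : w i = 1 := by
      have h01 : ∀ x : ZMod 2, x = 0 ∨ x = 1 := by decide
      rcases h01 (w i) with h | h
      · exact absurd h hi
      · exact h
    simp [hmem, h1]

/-- Syndrome words track vectors: for qubit indices `J` (all `< n`),
`ofBits |H| (⊕_{j∈J} colMask H j) = H (ofBits n (⊕_{j∈J} 2^j))`. -/
theorem ofBits_xorList_colMask (J : List ℕ) (hJ : ∀ j ∈ J, j < n) :
    ofBits H.length (xorList (J.map (colMask H))) =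
      rowMatrix n H *ᵥ ofBits n (xorList (J.map fun j => 2 ^ j)) := by
  induction J with
  | nil => simp [xorList, ofBits_zero]
  | cons a J ih =>
    have ha : a < n := hJ a (by simp)
    rw [List.map_cons, List.map_cons, xorList, xorList, ofBits_xor, ofBits_xor, Matrix.mulVec_add,
      ih fun j hj => hJ j (by simp [hj]), ofBits_two_pow n a ha, Matrix.mulVec_single_one, ofBits_colMask n H a ha]

/-- The syndrome word of the support list is `H w`. -/
theorem ofBits_xorSnd_suppList (w : Fin n → ZMod 2) :
    ofBits H.length (xorSnd (suppList n H w)) = rowMatrix n H *ᵥ w := by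
  have hx : xorSnd (suppList n H w) = xorList ((suppIdx n w).map (colMask H)) := by
    rw [xorSnd, suppList, List.map_map]
    rfl
  rw [hx, ofBits_xorList_colMask n H _ fun j hj => lt_of_mem_suppIdx n w hj]
  congr 1
  have := ofBits_xorFst_suppList n H w
  rw [xorFst, suppList, List.map_map] at this
  exact this

/-- If `H w = 0` then the syndrome word of the support list of `w` is `0`. -/
theorem xorSnd_suppList_eq_zero (w : Fin n → ZMod 2) (hw : rowMatrix n H *ᵥ w = 0) :
    xorSnd (suppList n H w) = 0 := by
  have hlt : xorSnd (suppList n H w) < 2 ^ H.length := by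
    refine xorList_lt _ _ fun x hx => ?_
    simp only [suppList, List.map_map, List.mem_map] at hx
    obtain ⟨j, -, rfl⟩ := hx
    exact colMask_lt H j
  have h := ofBits_xorSnd_suppList n H w
  rw [hw] at h
  by_contra hne
  obtain ⟨r, hr⟩ := Nat.exists_testBit_of_ne_zero hne
  have hrm : r < H.length := by
    by_contra hge
    rw [not_lt] at hge
    rw [Nat.testBit_lt_two_pow (lt_of_lt_of_le hlt (Nat.pow_le_pow_right (by norm_num) hge))] at hr
    exact Bool.false_ne_true hr
  have := congrFun h ⟨r, hrm⟩
  simp [ofBits, hr] at this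

end Support

/-! ## What a passing replay establishes, and its chunked form (CERT-FORMAT §7) -/

section Reaches

/-- `Reaches test L b v s`: `test` holds at `(v ⊕ xorFst S, s ⊕ xorSnd S)` for every sublist `S` of `L` of length
`≤ b` — the content of a passing replay, however it was computed (one `scan`, or chunk by chunk). -/
def Reaches (test : ℕ → ℕ → Bool) (L : List (ℕ × ℕ)) (b v s : ℕ) : Prop :=
  ∀ S : List (ℕ × ℕ), S.Sublist L → S.length ≤ b → test (v ^^^ xorFst S) (s ^^^ xorSnd S) = true

/-- A passing `scan` reaches everything (= `scan_sublist`). -/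
theorem reaches_of_scan {test : ℕ → ℕ → Bool} {L : List (ℕ × ℕ)} {b v s : ℕ} (h : scan test L b v s = true) :
    Reaches test L b v s :=
  scan_sublist test L b v s h

/-- `Reaches` is antitone in the budget. -/
theorem Reaches.mono {test : ℕ → ℕ → Bool} {L : List (ℕ × ℕ)} {b b' v s : ℕ} (hb : b ≤ b')
    (h : Reaches test L b' v s) : Reaches test L b v s :=
  fun S hS hlen => h S hS (le_trans hlen hb)

/-- **Chunking by the first selected position**: if `test` holds at the start point and, for every position `i` of
`L`, the replay of budget `b` over the positions AFTER `i` starting from (start ⊕ position `i`) reaches everything,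
then the replay of budget `b + 1` over `L` reaches everything (every nonempty sublist has a first element). -/
theorem reaches_of_chunks {test : ℕ → ℕ → Bool} :
    ∀ (L : List (ℕ × ℕ)) (b v s : ℕ), test v s = true →
      (∀ (i : ℕ) (hi : i < L.length), Reaches test (L.drop (i + 1)) b (v ^^^ (L[i]).1) (s ^^^ (L[i]).2)) →
      Reaches test L (b + 1) v s := by
  intro L
  induction L with
  | nil =>
    intro b v s h0 _ S hS _
    rw [List.sublist_nil.mp hS]
    simpa [xorFst, xorSnd, xorList] using h0
  | cons a L ih =>
    intro b v s h0 hch S hS hlen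
    rcases hS with _ | ⟨_, hS'⟩ | ⟨_, hS'⟩
    · refine ih b v s h0 (fun i hi => ?_) S hS' hlen
      have hi' : i + 1 < (a :: L).length := by simpa using hi
      have := hch (i + 1) hi'
      simpa using this
    · rename_i S'
      have hlen' : S'.length ≤ b := by simpa using hlen
      have h0' : 0 < (a :: L).length := by simp
      have := hch 0 h0' S' hS' hlen'
      rw [xorFst_cons, xorSnd_cons]
      simpa [Nat.xor_assoc] using this

end Reaches

end Summit.Ventures.QEC.Census
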